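import Summits.CriticalPhenomena.PercolationContinuityZ3.Theorems.PercNearOneGluingNoHeavyLowerTailKnQuestion8CoefficientwiseRootSetKernelRowTwoPrep
import Summits.CriticalPhenomena.PercolationContinuityZ3.Theorems.PercNearOneGluingNoHeavyLowerTailKnQuestion8CoefficientwiseRootSetKernelTop
import HarnessLib

/-!
# The root-set kernel: ROW 2 of RCSET when `q` is isolated, and the pendant `γ`-sum — prim-lf-2 gen 60

Support file (`--supports stmt-CriticalPhenomena-4575`, closed), prover `prim-lf-2` (gen 60).  No definitions, no named facts, no sorries; standard axioms.
Memo `prim-lf-2/CW-ATOM-gen60.md` §5; companions `…RootSetKernelTop.lean` (`rcset_top_row`), `…RootSetKernelRowTwoPrep.lean` (set-cluster primitives),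
`…RootSetKernelRowTwoNoAq.lean` (the pendant case `a = 0`, which is reduced to the present file).

Kernel notation: `R_A(t) = {v | ∃ a ∈ A, v ∈ C_a(t)}`, `B_A(t) = R_A(E ∖ t)`, `Φ(A,A') = Σ_{t ⊆ E : ¬(y∈R_A(t) ∧ y∈B_{A'}(t))} T(R_A(t), B_{A'}(t))`, `T(X,Y) = (fX − fY)(gX − gY)`.
* `Coefficientwise.pendant_powerset_sum` — the elementary `γ`-sum over the colourings of a bundle `C` of edges hanging a vertex `q` on `y`: if `(R γ, B γ)` equals `(R₀,B₀)` except
  that `q` joins `R` when `y ∈ R₀ ∧ γ ≠ ∅` and joins `B` when `y ∈ B₀ ∧ γ ≠ C`, then `Σ_{γ ⊆ C} adm·T(Rγ,Bγ) = adm₀·[T(R₀,B₀) + (2^{|C|} − 1)·T(R₁,B₁)]`.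
* `Coefficientwise.rcset_row_two_isolated` — **ROW 2 of RCSET when `q` has no non-loop edge**: `Φ(U,U) ≤ 2·Φ(S,U)` (`U = V ∖ {y,q}`, `y,q ∉ S`).  Proof: with `W = V ∖ y` one has
  `R_W = R_U + q` and `q ∉ R_U, R_S`, so the row is the top row `rcset_top_row` for the monotone functions `X ↦ f(X ∖ q)`, `X ↦ g(X ∖ q)`.
[cite: KozmaNitzan2024, Questions 8–9 (§5.5 p. 36) (context: the Question-8 pocket covariance programme)]
-/

namespace Summit.CriticalPhenomena.PercolationContinuityZ3.Theorems

open Finset Literature.Probability.Percolation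

namespace Coefficientwise

variable {ι V : Type*}

open Classical in
/-- **Pendant `γ`-sum.**  Let `C` be a finset, `R B : Finset ι → Set V`, and suppose: `y ∈ R γ ↔ y ∈ R₀` and `y ∈ B γ ↔ y ∈ B₀` for all `γ ⊆ C`; `R γ = R₀` whenever `y ∉ R₀` or `γ = ∅`,
and `R γ = R₁` whenever `y ∈ R₀` and `γ ≠ ∅`; `B γ = B₀` whenever `y ∉ B₀` or `γ = C`, and `B γ = B₁` whenever `y ∈ B₀` and `γ ≠ C`; finally `R₁ = R₀` if `y ∉ R₀` and `B₁ = B₀` if `y ∉ B₀`.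
Then `Σ_{γ ⊆ C} [¬(y∈Rγ ∧ y∈Bγ)]·T(Rγ,Bγ) = [¬(y∈R₀ ∧ y∈B₀)]·(T(R₀,B₀) + #(C.powerset ∖ {∅})·T(R₁,B₁))`. [folklore] -/
theorem pendant_powerset_sum [DecidableEq ι] (C : Finset ι) (y : V) (R B : Finset ι → Set V) (R₀ B₀ R₁ B₁ : Set V)
    (hyR : ∀ γ, γ ⊆ C → (y ∈ R γ ↔ y ∈ R₀)) (hyB : ∀ γ, γ ⊆ C → (y ∈ B γ ↔ y ∈ B₀))
    (hRn : ∀ γ, γ ⊆ C → y ∉ R₀ → R γ = R₀) (hRe : R ∅ = R₀) (hR1 : ∀ γ, γ ⊆ C → y ∈ R₀ → γ ≠ ∅ → R γ = R₁)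
    (hBn : ∀ γ, γ ⊆ C → y ∉ B₀ → B γ = B₀) (hBC : B C = B₀) (hB1 : ∀ γ, γ ⊆ C → y ∈ B₀ → γ ≠ C → B γ = B₁)
    (hR1' : y ∉ R₀ → R₁ = R₀) (hB1' : y ∉ B₀ → B₁ = B₀) (f g : Set V → ℝ) :
    ∑ γ ∈ C.powerset, (if ¬ (y ∈ R γ ∧ y ∈ B γ) then (f (R γ) - f (B γ)) * (g (R γ) - g (B γ)) else 0) =
      if ¬ (y ∈ R₀ ∧ y ∈ B₀) then (f R₀ - f B₀) * (g R₀ - g B₀) + ((C.powerset.erase ∅).card : ℝ) * ((f R₁ - f B₁) * (g R₁ - g B₁)) else 0 := by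
  by_cases hadm : y ∈ R₀ ∧ y ∈ B₀
  · -- inadmissible: every term vanishes
    rw [if_neg (not_not.mpr hadm)]
    refine Finset.sum_eq_zero fun γ hγ => ?_
    have hγC := Finset.mem_powerset.mp hγ
    rw [if_neg (not_not.mpr ⟨(hyR γ hγC).mpr hadm.1, (hyB γ hγC).mpr hadm.2⟩)]
  rw [if_pos hadm]
  have hterm : ∀ γ ∈ C.powerset, (if ¬ (y ∈ R γ ∧ y ∈ B γ) then (f (R γ) - f (B γ)) * (g (R γ) - g (B γ)) else 0) =
      (f (R γ) - f (B γ)) * (g (R γ) - g (B γ)) := by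
    intro γ hγ
    have hγC := Finset.mem_powerset.mp hγ
    rw [if_pos (fun h => hadm ⟨(hyR γ hγC).mp h.1, (hyB γ hγC).mp h.2⟩)]
  rw [Finset.sum_congr rfl hterm]
  have h0mem : (∅ : Finset ι) ∈ C.powerset := Finset.mem_powerset.mpr (Finset.empty_subset C)
  have hCmem : C ∈ C.powerset := Finset.mem_powerset.mpr subset_rfl
  have hcard : (C.powerset.erase C).card = (C.powerset.erase ∅).card := by
    rw [Finset.card_erase_of_mem hCmem, Finset.card_erase_of_mem h0mem]
  by_cases hyR0 : y ∈ R₀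
  · -- `y ∈ R₀`, `y ∉ B₀`: split off `γ = ∅`
    have hyB0 : y ∉ B₀ := fun h => hadm ⟨hyR0, h⟩
    rw [← Finset.add_sum_erase _ _ h0mem, hRe, hBn ∅ (Finset.empty_subset C) hyB0]
    have hrest : ∀ γ ∈ C.powerset.erase ∅, (f (R γ) - f (B γ)) * (g (R γ) - g (B γ)) = (f R₁ - f B₁) * (g R₁ - g B₁) := by
      intro γ hγ
      obtain ⟨hγ0, hγ1⟩ := Finset.mem_erase.mp hγ
      have hγC := Finset.mem_powerset.mp hγ1
      rw [hR1 γ hγC hyR0 hγ0, hBn γ hγC hyB0, hB1' hyB0]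
    rw [Finset.sum_congr rfl hrest, Finset.sum_const, nsmul_eq_mul]
  · by_cases hyB0 : y ∈ B₀
    · -- `y ∉ R₀`, `y ∈ B₀`: split off `γ = C`
      rw [← Finset.add_sum_erase _ _ hCmem, hRn C subset_rfl hyR0, hBC]
      have hrest : ∀ γ ∈ C.powerset.erase C, (f (R γ) - f (B γ)) * (g (R γ) - g (B γ)) = (f R₁ - f B₁) * (g R₁ - g B₁) := by
        intro γ hγ
        obtain ⟨hγ0, hγ1⟩ := Finset.mem_erase.mp hγ
        have hγC := Finset.mem_powerset.mp hγ1
        rw [hRn γ hγC hyR0, hR1' hyR0, hB1 γ hγC hyB0 hγ0]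
      rw [Finset.sum_congr rfl hrest, Finset.sum_const, nsmul_eq_mul, hcard]
    · -- neither: all terms equal
      rw [← Finset.add_sum_erase _ _ h0mem, hRe, hBn ∅ (Finset.empty_subset C) hyB0]
      have hrest : ∀ γ ∈ C.powerset.erase ∅, (f (R γ) - f (B γ)) * (g (R γ) - g (B γ)) = (f R₁ - f B₁) * (g R₁ - g B₁) := by
        intro γ hγ
        obtain ⟨_, hγ1⟩ := Finset.mem_erase.mp hγ
        have hγC := Finset.mem_powerset.mp hγ1
        rw [hRn γ hγC hyR0, hBn γ hγC hyB0, hR1' hyR0, hB1' hyB0]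
      rw [Finset.sum_congr rfl hrest, Finset.sum_const, nsmul_eq_mul]

open Classical in
/-- **Row 2 of RCSET when `q` is isolated** (see the module docstring): for finite `V`, `y ≠ q`, `U = V ∖ {y, q}`, `y, q ∉ S`, monotone `f, g`, and no non-loop edge of `E` at `q`:
`Φ(U,U) ≤ 2·Φ(S,U)` for the root-set kernel `Φ` of `(ends, E, y, f, g)`. [cite: KozmaNitzan2024, Questions 8–9 (§5.5 p. 36) (context)] -/
theorem rcset_row_two_isolated [Fintype V] [DecidableEq V] (ends : ι → Sym2 V) (E : Finset ι) (y q : V) (hyq : y ≠ q) (S : Finset V) (hyS : y ∉ S) (hqS : q ∉ S)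
    (hq : ∀ i ∈ E, ∀ w : V, w ≠ q → ends i ≠ s(w, q))
    (f g : Set V → ℝ) (hf : Monotone f) (hg : Monotone g) :
    (∑ s ∈ E.powerset.filter (fun s : Finset ι =>
          ¬ ((∃ a ∈ ((Finset.univ : Finset V).erase y).erase q, y ∈ openCluster (ends '' (↑s : Set ι)) a) ∧
             (∃ a ∈ ((Finset.univ : Finset V).erase y).erase q, y ∈ openCluster (ends '' (↑(E \ s) : Set ι)) a))),
        (f {v | ∃ a ∈ ((Finset.univ : Finset V).erase y).erase q, v ∈ openCluster (ends '' (↑s : Set ι)) a} -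
            f {v | ∃ a ∈ ((Finset.univ : Finset V).erase y).erase q, v ∈ openCluster (ends '' (↑(E \ s) : Set ι)) a}) *
          (g {v | ∃ a ∈ ((Finset.univ : Finset V).erase y).erase q, v ∈ openCluster (ends '' (↑s : Set ι)) a} -
            g {v | ∃ a ∈ ((Finset.univ : Finset V).erase y).erase q, v ∈ openCluster (ends '' (↑(E \ s) : Set ι)) a})) ≤
    2 * ∑ s ∈ E.powerset.filter (fun s : Finset ι =>
          ¬ ((∃ a ∈ S, y ∈ openCluster (ends '' (↑s : Set ι)) a) ∧
             (∃ a ∈ ((Finset.univ : Finset V).erase y).erase q, y ∈ openCluster (ends '' (↑(E \ s) : Set ι)) a))),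
        (f {v | ∃ a ∈ S, v ∈ openCluster (ends '' (↑s : Set ι)) a} -
            f {v | ∃ a ∈ ((Finset.univ : Finset V).erase y).erase q, v ∈ openCluster (ends '' (↑(E \ s) : Set ι)) a}) *
          (g {v | ∃ a ∈ S, v ∈ openCluster (ends '' (↑s : Set ι)) a} -
            g {v | ∃ a ∈ ((Finset.univ : Finset V).erase y).erase q, v ∈ openCluster (ends '' (↑(E \ s) : Set ι)) a}) := by
  -- notation
  set U : Finset V := ((Finset.univ : Finset V).erase y).erase q with hU
  set W : Finset V := (Finset.univ : Finset V).erase y with hW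
  set RU : Finset ι → Set V := fun t => {v | ∃ a ∈ U, v ∈ openCluster (ends '' (↑t : Set ι)) a} with hRU
  set RS : Finset ι → Set V := fun t => {v | ∃ a ∈ S, v ∈ openCluster (ends '' (↑t : Set ι)) a} with hRS
  set RW : Finset ι → Set V := fun t => {v | ∃ a ∈ W, v ∈ openCluster (ends '' (↑t : Set ι)) a} with hRW
  set admU : Finset ι → Prop := fun s => ¬ ((∃ a ∈ U, y ∈ openCluster (ends '' (↑s : Set ι)) a) ∧
      (∃ a ∈ U, y ∈ openCluster (ends '' (↑(E \ s) : Set ι)) a)) with hadmU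
  set admS : Finset ι → Prop := fun s => ¬ ((∃ a ∈ S, y ∈ openCluster (ends '' (↑s : Set ι)) a) ∧
      (∃ a ∈ U, y ∈ openCluster (ends '' (↑(E \ s) : Set ι)) a)) with hadmS
  set TU : Finset ι → ℝ := fun s => (f (RU s) - f (RU (E \ s))) * (g (RU s) - g (RU (E \ s))) with hTU
  set TS : Finset ι → ℝ := fun s => (f (RS s) - f (RU (E \ s))) * (g (RS s) - g (RU (E \ s))) with hTS
  change ∑ s ∈ E.powerset.filter admU, TU s ≤ 2 * ∑ s ∈ E.powerset.filter admS, TS s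
  have hqU : q ∉ U := fun h => (Finset.mem_erase.mp h).1 rfl
  have hqW : q ∈ W := Finset.mem_erase.mpr ⟨hyq.symm, Finset.mem_univ q⟩
  have hUW : U ⊆ W := Finset.erase_subset _ _
  -- `q` is never reached from a set not containing it
  have q_notin : ∀ (A : Finset V) (t : Finset ι), q ∉ A → t ⊆ E → q ∉ {v | ∃ a ∈ A, v ∈ openCluster (ends '' (↑t : Set ι)) a} :=
    fun A t hqA ht => not_mem_setCluster_of_isolated ends hqA fun i hi w hwq => hq i (ht hi) w hwq
  -- the red cluster of `W = U + q` is the red cluster of `U` plus `q`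
  have RW_eq : ∀ t : Finset ι, t ⊆ E → RW t = insert q (RU t) := by
    intro t ht
    ext v
    constructor
    · rintro ⟨a, ha, hva⟩
      by_cases haq : a = q
      · subst haq
        by_cases hvq : v = a
        · exact hvq ▸ Set.mem_insert _ _
        · have hqv : a ∈ {w | ∃ b ∈ ({v} : Finset V), w ∈ openCluster (ends '' (↑t : Set ι)) b} :=
            ⟨v, Finset.mem_singleton_self v, SimpleGraph.Reachable.symm hva⟩
          exact absurd hqv (q_notin {v} t (fun h => hvq (Finset.mem_singleton.mp h).symm) ht)
      · exact Set.mem_insert_of_mem _ ⟨a, Finset.mem_erase.mpr ⟨haq, ha⟩, hva⟩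
    · intro hv
      rcases Set.mem_insert_iff.mp hv with hv | ⟨a, ha, hva⟩
      · subst hv; exact ⟨_, hqW, mem_openCluster_self _ _⟩
      · exact ⟨a, hUW ha, hva⟩
  -- the modified functions `X ↦ f(X ∖ q)`
  set fm : Set V → ℝ := fun X => f {v | v ∈ X ∧ v ≠ q} with hfm
  set gm : Set V → ℝ := fun X => g {v | v ∈ X ∧ v ≠ q} with hgm
  have sub_m : ∀ X X' : Set V, X ⊆ X' → {v | v ∈ X ∧ v ≠ q} ⊆ {v | v ∈ X' ∧ v ≠ q} := fun X X' h v ⟨hv, hvq⟩ => ⟨h hv, hvq⟩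
  have hfm_mono : Monotone fm := fun X X' h => hf (sub_m X X' h)
  have hgm_mono : Monotone gm := fun X X' h => hg (sub_m X X' h)
  have strip_insert : ∀ X : Set V, q ∉ X → {v | v ∈ insert q X ∧ v ≠ q} = X := by
    intro X hqX; ext v; constructor
    · rintro ⟨hv, hvq⟩; exact (Set.mem_insert_iff.mp hv).resolve_left hvq
    · intro hv; exact ⟨Set.mem_insert_of_mem _ hv, fun h => hqX (h ▸ hv)⟩
  have strip_self : ∀ X : Set V, q ∉ X → {v | v ∈ X ∧ v ≠ q} = X := by
    intro X hqX; ext v; constructor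
    · rintro ⟨hv, _⟩; exact hv
    · intro hv; exact ⟨hv, fun h => hqX (h ▸ hv)⟩
  have yRW : ∀ t : Finset ι, t ⊆ E → (y ∈ RW t ↔ y ∈ RU t) := by
    intro t ht; rw [RW_eq t ht, Set.mem_insert_iff]; exact ⟨fun h => h.resolve_left hyq, Or.inr⟩
  have hqRU : ∀ t : Finset ι, t ⊆ E → q ∉ RU t := fun t ht => q_notin U t hqU ht
  have hqRS : ∀ t : Finset ι, t ⊆ E → q ∉ RS t := fun t ht => q_notin S t hqS ht
  -- the top row for `(fm, gm)`, rewritten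
  have top := rcset_top_row ends E y S hyS fm gm hfm_mono hgm_mono
  rw [Finset.sum_filter, Finset.sum_filter] at top
  rw [Finset.sum_filter, Finset.sum_filter]
  have e1 : ∀ t ∈ E.powerset, (if ¬ ((∃ a ∈ W, y ∈ openCluster (ends '' (↑t : Set ι)) a) ∧ (∃ a ∈ W, y ∈ openCluster (ends '' (↑(E \ t) : Set ι)) a))
        then (fm (RW t) - fm (RW (E \ t))) * (gm (RW t) - gm (RW (E \ t))) else 0) = (if admU t then TU t else 0) := by
    intro t ht
    have htE : t ⊆ E := Finset.mem_powerset.mp ht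
    have hcE : E \ t ⊆ E := Finset.sdiff_subset
    have hc : (¬ ((∃ a ∈ W, y ∈ openCluster (ends '' (↑t : Set ι)) a) ∧ (∃ a ∈ W, y ∈ openCluster (ends '' (↑(E \ t) : Set ι)) a))) ↔ admU t := by
      change ¬ (y ∈ RW t ∧ y ∈ RW (E \ t)) ↔ ¬ (y ∈ RU t ∧ y ∈ RU (E \ t))
      rw [yRW t htE, yRW _ hcE]
    by_cases h : admU t
    · rw [if_pos (hc.mpr h), if_pos h]
      simp only [hfm, hgm, hTU, RW_eq t htE, RW_eq _ hcE, strip_insert _ (hqRU t htE), strip_insert _ (hqRU _ hcE)]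
    · rw [if_neg (fun h' => h (hc.mp h')), if_neg h]
  have e2 : ∀ t ∈ E.powerset, (if ¬ ((∃ a ∈ S, y ∈ openCluster (ends '' (↑t : Set ι)) a) ∧ (∃ a ∈ W, y ∈ openCluster (ends '' (↑(E \ t) : Set ι)) a))
        then (fm (RS t) - fm (RW (E \ t))) * (gm (RS t) - gm (RW (E \ t))) else 0) = (if admS t then TS t else 0) := by
    intro t ht
    have htE : t ⊆ E := Finset.mem_powerset.mp ht
    have hcE : E \ t ⊆ E := Finset.sdiff_subset
    have hc : (¬ ((∃ a ∈ S, y ∈ openCluster (ends '' (↑t : Set ι)) a) ∧ (∃ a ∈ W, y ∈ openCluster (ends '' (↑(E \ t) : Set ι)) a))) ↔ admS t := by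
      change ¬ (y ∈ RS t ∧ y ∈ RW (E \ t)) ↔ ¬ (y ∈ RS t ∧ y ∈ RU (E \ t))
      rw [yRW _ hcE]
    by_cases h : admS t
    · rw [if_pos (hc.mpr h), if_pos h]
      simp only [hfm, hgm, hTS, RW_eq _ hcE, strip_self _ (hqRS t htE), strip_insert _ (hqRU _ hcE)]
    · rw [if_neg (fun h' => h (hc.mp h')), if_neg h]
  rw [Finset.sum_congr rfl e1, Finset.sum_congr rfl e2] at top
  exact top

end Coefficientwise

end Summit.CriticalPhenomena.PercolationContinuityZ3.Theorems
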